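import Literature.NumberTheory.Sieve.MaierSieveOscillation
import Literature.Barriers.Parity.MaierMatrix
import Literature.NumberTheory.Sieve.RoughNumbersInProgressions
import Literature.NumberTheory.Sieve.RoughNumbersCoprimeProgressions
import Literature.NumberTheory.Sieve.ParityWave0Proofs
import Literature.NumberTheory.LFunctions.MertensElementary
import Literature.NumberTheory.LFunctions.RHWave0PNTProofs
import HarnessLib

/-!
# Tools for the Friedlander–Granville uniformity theorem: totient weights, prime counts in
# segments of progressions against `ψ(x; q, a)`, Brun–Titchmarsh and the prime number theorem

Topic `Literature/Barriers/Parity` (support file for the proof of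
`Literature.Barriers.Parity.FriedlanderGranvilleUniformityBarrier`, Friedlander–Granville,
*Limitations to the equi-distribution of primes III*, Compositio Math. 81 (1992), Theorem p. 20).
Everything here is PROVED; the definitions are elementary data: the weight `primeWeight`, and the
`ℕ`-indexed `thetaMod` / `colCount` (deliberately in the shape of the tree's
`sum_log_prime_modEq_le_chebyshevPsiMod`; a real-height `ϑ(x; q, a)` also exists as
`BFIReduction.thetaMod` in `BombieriFriedlanderIwaniecProofs.lean`, not imported here).
Grouping namespace `Literature.Barriers.Parity.FriedlanderGranville`.

* **Totient weights** (§5 of the source: "`rφ(P)/φ(rP) = r'/φ(r')`", "`q/φ(q) = 1 + O(1/log log z)`",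
  Lemma 3): `primeWeight Ps n = ∏_{p ∈ Ps, p ∣ n} p/(p−1)`; the expansion
  `primeWeight Ps n = ∑_{t ⊆ Ps, ∏t ∣ n} ∏_{p∈t} 1/(p−1)` (`primeWeight_eq_sum`), its sum over a
  set of integers (`sum_primeWeight_eq`), the evaluation `∑_{t ⊆ Ps} ∏ 1/(p−1) (X/∏t + B)
  = X ∏(1 + 1/(p(p−1))) + B ∏ p/(p−1)` (`sum_powerset_weight_eq`) and the bounds
  `∏_{p∈Ps}(1 + 1/(p(p−1))) ≤ exp(1/m)` for primes `> m` (`prod_one_add_le_exp_inv`),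
  `n/φ(n) = primeWeight Ps n` when `Ps ⊇` primes of `n`, `rφ(P)/φ(rP) = primeWeight Ps r` when `Ps`
  contains the primes of `r` outside `P` and none of `P` (`totient_mul_weight`).
  (These replace the pointwise Lemma 3 of the source by averaged statements.)
* **Columns of the matrix** (source (5.2)–(5.4)): for a progression `j (mod M)` and a segment
  `(X₁, X₂]`, the prime count `C = #{X₁ < p ≤ X₂ : p ≡ j (M)}` against `ψ(·; M, j)`:
  `C log X₂ ≥ ψ(X₂;M,j) − ψ(X₁;M,j) − (ψ(X₂) − ϑ(X₂))` (`card_primes_mul_log_ge`) and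
  `C ≤ W + 1 + (ψ(X₂;M,j) − ψ(W';M,j) + (ψ(W') − ϑ(W')))/log W` with `W' = max(X₁, W)`
  (`card_primes_le`), from the tree's sandwich `ϑ(x;q,a) ≤ ψ(x;q,a) ≤ ϑ(x;q,a) + ψ(x) − ϑ(x)`.
* **Brun–Titchmarsh for a column** (source (5.4)): `C ≤ K (X₂/(φ(M) log z) + z^{10}) + z` for
  `(j, M) = 1`, `z ≥ 2` (`card_primes_le_brunTitchmarsh`, from the tree's `card_roughAP_le`).
* **The prime number theorem for `π`** (`primeCounting_bounds`: `(1 ± ε) x/log x`, from the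
  tree's `primeCounting_isEquivalent_holds`), and Mertens-type bounds for sieve densities.

## References

* J. Friedlander, A. Granville, Compositio Math. 81 (1992), §4 Lemma 3, §5 (5.2)–(5.8)
  (`FriedlanderGranville1992`).
* H. L. Montgomery, R. C. Vaughan, *Multiplicative Number Theory I* (2007), proof of Cor. 11.20
  (`MontgomeryVaughan2007`).
-/

noncomputable section

open Finset Filter
open scoped ArithmeticFunction.vonMangoldt

namespace Literature.Barriers.Parity.FriedlanderGranville

open Literature.NumberTheory.Sieve Literature.NumberTheory.Sieve.MaierMatrix
open Literature.NumberTheory.Sieve.ParityWave0 (chebyshevPsiMod)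

/-! ## Totient weights -/

/-- `primeWeight Ps n = ∏_{p ∈ Ps, p ∣ n} p/(p − 1)`: the factor by which `φ` falls short of
multiplicativity on the primes of `Ps` (for `Ps ⊇` primes of `n` this is `n/φ(n)`; for `Ps` = the
primes of `r` outside `P` it is `rφ(P)/φ(rP) = r'/φ(r')` of the source).
[cite: FriedlanderGranville1992, §5 (after (5.6))] -/
def primeWeight (Ps : Finset ℕ) (n : ℕ) : ℝ :=
  ∏ p ∈ Ps.filter (· ∣ n), ((p : ℝ) / ((p : ℝ) - 1))

/-- `primeWeight Ps n ≥ 1` for a set of primes `Ps`. [folklore] -/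
theorem one_le_primeWeight {Ps : Finset ℕ} (hPs : ∀ p ∈ Ps, p.Prime) (n : ℕ) : 1 ≤ primeWeight Ps n := by
  unfold primeWeight
  refine one_le_prod fun p hp ↦ ?_
  have hp2 : (2 : ℝ) ≤ p := by exact_mod_cast (hPs p (mem_filter.1 hp).1).two_le
  rw [le_div_iff₀ (by linarith)]
  linarith

/-- `p/(p−1) = 1 + 1/(p−1)` turns the weight into a sum over subsets:
`primeWeight Ps n = ∑_{t ⊆ Ps, ∏t ∣ n} ∏_{p ∈ t} 1/(p − 1)` for a set of primes `Ps`. [folklore] -/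
theorem primeWeight_eq_sum {Ps : Finset ℕ} (hPs : ∀ p ∈ Ps, p.Prime) (n : ℕ) :
    primeWeight Ps n =
      ∑ t ∈ Ps.powerset, if (∏ p ∈ t, p) ∣ n then ∏ p ∈ t, ((p : ℝ) - 1)⁻¹ else 0 := by
  classical
  unfold primeWeight
  have h1 : ∏ p ∈ Ps.filter (· ∣ n), ((p : ℝ) / ((p : ℝ) - 1)) =
      ∏ p ∈ Ps.filter (· ∣ n), (1 + ((p : ℝ) - 1)⁻¹) := by
    refine prod_congr rfl fun p hp ↦ ?_
    have hp2 : (2 : ℝ) ≤ p := by exact_mod_cast (hPs p (mem_filter.1 hp).1).two_le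
    have hp1 : (p : ℝ) - 1 ≠ 0 := by linarith
    field_simp
    ring
  rw [h1, prod_one_add, ← sum_filter]
  refine sum_congr ?_ fun t _ ↦ rfl
  ext t
  simp only [mem_powerset, mem_filter]
  constructor
  · intro ht
    refine ⟨fun p hp ↦ (mem_filter.1 (ht hp)).1, ?_⟩
    refine Finset.prod_primes_dvd n (fun p hp ↦ Nat.prime_iff.1 (hPs p (mem_filter.1 (ht hp)).1))
      fun p hp ↦ (mem_filter.1 (ht hp)).2
  · rintro ⟨ht, hdvd⟩ p hp
    exact mem_filter.2 ⟨ht hp, (dvd_prod_of_mem _ hp).trans hdvd⟩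

/-- Summing the weight over a finite set of integers:
`∑_{n ∈ Ns} primeWeight Ps n = ∑_{t ⊆ Ps} (∏_{p∈t} 1/(p−1)) · #{n ∈ Ns : ∏t ∣ n}`. [folklore] -/
theorem sum_primeWeight_eq {Ps : Finset ℕ} (hPs : ∀ p ∈ Ps, p.Prime) (Ns : Finset ℕ) :
    ∑ n ∈ Ns, primeWeight Ps n =
      ∑ t ∈ Ps.powerset, (∏ p ∈ t, ((p : ℝ) - 1)⁻¹) * #{n ∈ Ns | (∏ p ∈ t, p) ∣ n} := by
  classical
  simp_rw [primeWeight_eq_sum hPs]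
  rw [sum_comm]
  refine sum_congr rfl fun t _ ↦ ?_
  rw [card_filter, Nat.cast_sum, mul_sum]
  refine sum_congr rfl fun n _ ↦ ?_
  split_ifs <;> simp

/-- Evaluation of the subset sums: for a set of primes `Ps` and reals `X, B`,
`∑_{t ⊆ Ps} (∏_{p∈t} 1/(p−1)) (X/∏t + B) = X ∏_{p∈Ps}(1 + 1/(p(p−1))) + B ∏_{p∈Ps}(1 + 1/(p−1))`. [folklore] -/
theorem sum_powerset_weight_eq {Ps : Finset ℕ} (hPs : ∀ p ∈ Ps, p.Prime) (X B : ℝ) :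
    ∑ t ∈ Ps.powerset, (∏ p ∈ t, ((p : ℝ) - 1)⁻¹) * (X / ((∏ p ∈ t, p : ℕ) : ℝ) + B) =
      X * ∏ p ∈ Ps, (1 + ((p : ℝ) * ((p : ℝ) - 1))⁻¹) + B * ∏ p ∈ Ps, (1 + ((p : ℝ) - 1)⁻¹) := by
  rw [prod_one_add, prod_one_add, mul_sum, mul_sum, ← sum_add_distrib]
  refine sum_congr rfl fun t ht ↦ ?_
  have htp : ∀ p ∈ t, p.Prime := fun p hp ↦ hPs p (mem_powerset.1 ht hp)
  have h1 : (∏ p ∈ t, ((p : ℝ) - 1)⁻¹) / ((∏ p ∈ t, p : ℕ) : ℝ) = ∏ p ∈ t, ((p : ℝ) * ((p : ℝ) - 1))⁻¹ := by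
    rw [Nat.cast_prod, div_eq_mul_inv, ← prod_inv_distrib, ← prod_mul_distrib]
    refine prod_congr rfl fun p hp ↦ ?_
    rw [mul_inv, mul_comm]
  rw [mul_add, ← mul_div_assoc, mul_div_right_comm, ← h1]
  ring

/-- `∑_{p ∈ Ps} 1/(p(p−1)) ≤ 1/m` when every element of `Ps` is an integer `> m ≥ 1`
(telescoping `1/(n(n−1)) = 1/(n−1) − 1/n`). [folklore] -/
theorem sum_inv_mul_pred_le {Ps : Finset ℕ} {m : ℕ} (hm : 1 ≤ m) (hPs : ∀ p ∈ Ps, m < p) :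
    ∑ p ∈ Ps, ((p : ℝ) * ((p : ℝ) - 1))⁻¹ ≤ (m : ℝ)⁻¹ := by
  -- compare with the telescoping sum over `(m, M]`
  have htel : ∀ M : ℕ, m ≤ M → ∑ n ∈ Ioc m M, ((n : ℝ) * ((n : ℝ) - 1))⁻¹ = (m : ℝ)⁻¹ - (M : ℝ)⁻¹ := by
    intro M hM
    induction M, hM using Nat.le_induction with
    | base => simp
    | succ M hmM ih =>
      rw [sum_Ioc_succ_top (by omega), ih]
      have hM0 : (M : ℝ) ≠ 0 := by exact_mod_cast (show M ≠ 0 by omega)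
      have hM1 : (M : ℝ) + 1 ≠ 0 := by positivity
      have e1 : (((M + 1 : ℕ) : ℝ) * (((M + 1 : ℕ) : ℝ) - 1))⁻¹ = (M : ℝ)⁻¹ - ((M : ℝ) + 1)⁻¹ := by
        push_cast
        rw [add_sub_cancel_right, inv_sub_inv hM0 hM1, inv_eq_one_div]
        congr 1 <;> ring
      rw [e1]
      push_cast
      ring
  set M : ℕ := max m (Ps.sup id) with hMdef
  have hmM : m ≤ M := le_max_left _ _
  have hsub : Ps ⊆ Ioc m M := fun p hp ↦
    mem_Ioc.2 ⟨hPs p hp, (le_sup (f := id) hp).trans (le_max_right _ _)⟩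
  have hM0 : (0 : ℝ) ≤ (M : ℝ)⁻¹ := by positivity
  calc ∑ p ∈ Ps, ((p : ℝ) * ((p : ℝ) - 1))⁻¹ ≤ ∑ n ∈ Ioc m M, ((n : ℝ) * ((n : ℝ) - 1))⁻¹ := by
        refine sum_le_sum_of_subset_of_nonneg hsub fun n hn _ ↦ ?_
        have : (1 : ℝ) < n := by exact_mod_cast (lt_of_le_of_lt hm (mem_Ioc.1 hn).1)
        have h2 : (0 : ℝ) < (n : ℝ) * ((n : ℝ) - 1) := by nlinarith
        positivity
    _ = (m : ℝ)⁻¹ - (M : ℝ)⁻¹ := htel M hmM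
    _ ≤ (m : ℝ)⁻¹ := by linarith

/-- `∏_{p ∈ Ps} (1 + 1/(p(p−1))) ≤ exp(1/m)` when every element of `Ps` is an integer `> m ≥ 1`. [folklore] -/
theorem prod_one_add_le_exp_inv {Ps : Finset ℕ} {m : ℕ} (hm : 1 ≤ m) (hPs : ∀ p ∈ Ps, m < p) :
    ∏ p ∈ Ps, (1 + ((p : ℝ) * ((p : ℝ) - 1))⁻¹) ≤ Real.exp ((m : ℝ)⁻¹) := by
  have hpos : ∀ p ∈ Ps, 0 ≤ ((p : ℝ) * ((p : ℝ) - 1))⁻¹ := by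
    intro p hp
    have : (1 : ℝ) < p := by exact_mod_cast (lt_of_le_of_lt hm (hPs p hp))
    have h2 : (0 : ℝ) < (p : ℝ) * ((p : ℝ) - 1) := by nlinarith
    positivity
  calc ∏ p ∈ Ps, (1 + ((p : ℝ) * ((p : ℝ) - 1))⁻¹) ≤ ∏ p ∈ Ps, Real.exp (((p : ℝ) * ((p : ℝ) - 1))⁻¹) :=
        prod_le_prod (fun p hp ↦ by linarith [hpos p hp]) fun p hp ↦ by
          linarith [Real.add_one_le_exp (((p : ℝ) * ((p : ℝ) - 1))⁻¹)]
    _ = Real.exp (∑ p ∈ Ps, ((p : ℝ) * ((p : ℝ) - 1))⁻¹) := by rw [Real.exp_sum]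
    _ ≤ Real.exp ((m : ℝ)⁻¹) := Real.exp_le_exp.2 (sum_inv_mul_pred_le hm hPs)

/-- `∏_{p ∈ Ps} (1 + 1/(p − 1)) = (W(Ps))⁻¹` where `W(Ps) = ∏_{p∈Ps}(1 − 1/p)` (`MaierMatrix.sieveDensity`),
for a set of primes `Ps`. [folklore] -/
theorem prod_one_add_inv_pred_eq {Ps : Finset ℕ} (hPs : ∀ p ∈ Ps, p.Prime) :
    ∏ p ∈ Ps, (1 + ((p : ℝ) - 1)⁻¹) = (sieveDensity Ps)⁻¹ := by
  rw [sieveDensity, ← prod_inv_distrib]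
  refine prod_congr rfl fun p hp ↦ ?_
  have hp2 : (2 : ℝ) ≤ p := by exact_mod_cast (hPs p hp).two_le
  have hp1 : (p : ℝ) - 1 ≠ 0 := by linarith
  have hp0 : (p : ℝ) ≠ 0 := by linarith
  field_simp
  ring

/-- For `n ≥ 1` and a set of primes `Ps` containing every prime factor of `n`:
`n/φ(n) = primeWeight Ps n`. [folklore] -/
theorem div_totient_eq_primeWeight {Ps : Finset ℕ} (hPs : ∀ p ∈ Ps, p.Prime) {n : ℕ} (hn : n ≠ 0)
    (hsub : n.primeFactors ⊆ Ps) : (n : ℝ) / (n.totient : ℝ) = primeWeight Ps n := by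
  have hfilter : Ps.filter (· ∣ n) = n.primeFactors := by
    ext p
    simp only [mem_filter, Nat.mem_primeFactors, ne_eq]
    constructor
    · rintro ⟨hp, hd⟩; exact ⟨hPs p hp, hd, hn⟩
    · rintro ⟨hp, hd, -⟩; exact ⟨hsub (Nat.mem_primeFactors.2 ⟨hp, hd, hn⟩), hd⟩
  rw [primeWeight, hfilter]
  have key := Nat.totient_mul_prod_primeFactors n
  have hφ0 : (0 : ℝ) < n.totient := by exact_mod_cast Nat.totient_pos.2 (Nat.pos_of_ne_zero hn)
  have hprod : (0 : ℝ) < ∏ p ∈ n.primeFactors, ((p : ℝ) - 1) :=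
    prod_pos fun p hp ↦ by
      have : (2 : ℝ) ≤ p := by exact_mod_cast (Nat.prime_of_mem_primeFactors hp).two_le
      linarith
  have key' : (n.totient : ℝ) * ∏ p ∈ n.primeFactors, (p : ℝ) = n * ∏ p ∈ n.primeFactors, ((p : ℝ) - 1) := by
    have := congrArg (fun m : ℕ ↦ (m : ℝ)) key
    push_cast at this
    rw [this]
    congr 1
    refine prod_congr rfl fun p hp ↦ ?_
    rw [Nat.cast_sub (Nat.prime_of_mem_primeFactors hp).one_le, Nat.cast_one]
  rw [prod_div_distrib, eq_div_iff hprod.ne', div_mul_eq_mul_div, div_eq_iff hφ0.ne', ← key']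
  ring

/-- **`rφ(P)/φ(rP)` as a weight** (source, §5: "`rφ(P)/φ(rP) = r'/φ(r')` where `r'` is the
largest divisor of `r` coprime to `P`"): for `r, P ≥ 1` and a set of primes `Ps` containing every
prime of `r` not dividing `P` and no prime dividing `P`,
`r φ(P) = φ(rP) · primeWeight Ps r`. [cite: FriedlanderGranville1992, §5 (after (5.6))] -/
theorem totient_mul_weight {Ps : Finset ℕ} (hPs : ∀ p ∈ Ps, p.Prime) {r P : ℕ} (hr : r ≠ 0) (hP : P ≠ 0)
    (hsub : ∀ p ∈ r.primeFactors, ¬ p ∣ P → p ∈ Ps) (hdisj : ∀ p ∈ Ps, ¬ p ∣ P) :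
    (r : ℝ) * (P.totient : ℝ) = ((r * P).totient : ℝ) * primeWeight Ps r := by
  -- `φ(rP) ∏_{p ∣ rP} p = rP ∏_{p ∣ rP}(p-1)` and similarly for `P`; the primes of `rP` are
  -- those of `P` together with those of `r` outside `P`, which are exactly `Ps.filter (· ∣ r)`.
  have hrP : r * P ≠ 0 := mul_ne_zero hr hP
  have hfilter : Ps.filter (· ∣ r) = (r * P).primeFactors \ P.primeFactors := by
    ext p
    rw [mem_filter, Finset.mem_sdiff, Nat.mem_primeFactors, Nat.mem_primeFactors]
    constructor
    · rintro ⟨hp, hd⟩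
      exact ⟨⟨hPs p hp, hd.trans (dvd_mul_right r P), hrP⟩, fun h ↦ hdisj p hp h.2.1⟩
    · rintro ⟨⟨hp, hd, -⟩, hnot⟩
      have hndP : ¬ p ∣ P := fun h ↦ hnot ⟨hp, h, hP⟩
      have hdr : p ∣ r := (Or.resolve_right ((Nat.Prime.dvd_mul hp).1 hd) hndP)
      exact ⟨hsub p (Nat.mem_primeFactors.2 ⟨hp, hdr, hr⟩) hndP, hdr⟩
  have hsubset : P.primeFactors ⊆ (r * P).primeFactors :=
    Nat.primeFactors_mono (dvd_mul_left P r) hrP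
  -- cast the two totient identities
  have castId : ∀ n : ℕ, (n.totient : ℝ) * ∏ p ∈ n.primeFactors, (p : ℝ) =
      n * ∏ p ∈ n.primeFactors, ((p : ℝ) - 1) := by
    intro n
    have := congrArg (fun m : ℕ ↦ (m : ℝ)) (Nat.totient_mul_prod_primeFactors n)
    push_cast at this
    rw [this]
    congr 1
    refine prod_congr rfl fun p hp ↦ ?_
    rw [Nat.cast_sub (Nat.prime_of_mem_primeFactors hp).one_le, Nat.cast_one]
  have h1 := castId (r * P)
  have h2 := castId P
  -- split the products over `(rP).primeFactors` into `P.primeFactors` and the rest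
  have hsplitp : ∏ p ∈ (r * P).primeFactors, (p : ℝ) =
      (∏ p ∈ P.primeFactors, (p : ℝ)) * ∏ p ∈ (r * P).primeFactors \ P.primeFactors, (p : ℝ) := by
    rw [← prod_sdiff hsubset, mul_comm]
  have hsplitm : ∏ p ∈ (r * P).primeFactors, ((p : ℝ) - 1) =
      (∏ p ∈ P.primeFactors, ((p : ℝ) - 1)) * ∏ p ∈ (r * P).primeFactors \ P.primeFactors, ((p : ℝ) - 1) := by
    rw [← prod_sdiff hsubset, mul_comm]
  have hW : primeWeight Ps r * ∏ p ∈ (r * P).primeFactors \ P.primeFactors, ((p : ℝ) - 1) =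
      ∏ p ∈ (r * P).primeFactors \ P.primeFactors, (p : ℝ) := by
    rw [primeWeight, hfilter, ← prod_mul_distrib]
    refine prod_congr rfl fun p hp ↦ ?_
    have : (2 : ℝ) ≤ p := by
      exact_mod_cast (Nat.prime_of_mem_primeFactors (Finset.mem_sdiff.1 hp).1).two_le
    have hp1 : (p : ℝ) - 1 ≠ 0 := by linarith
    field_simp
  -- positivity of the pieces
  have hA : (0 : ℝ) < ∏ p ∈ P.primeFactors, (p : ℝ) :=
    prod_pos fun p hp ↦ by exact_mod_cast (Nat.prime_of_mem_primeFactors hp).pos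
  have hB : (0 : ℝ) < ∏ p ∈ P.primeFactors, ((p : ℝ) - 1) :=
    prod_pos fun p hp ↦ by
      have : (2 : ℝ) ≤ p := by exact_mod_cast (Nat.prime_of_mem_primeFactors hp).two_le
      linarith
  have hC : (0 : ℝ) < ∏ p ∈ (r * P).primeFactors \ P.primeFactors, ((p : ℝ) - 1) :=
    prod_pos fun p hp ↦ by
      have : (2 : ℝ) ≤ p := by
        exact_mod_cast (Nat.prime_of_mem_primeFactors (mem_sdiff.1 hp).1).two_le
      linarith
  rw [hsplitp, hsplitm] at h1
  push_cast at h1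
  -- from `h1`: φ(rP) A D = rP B C·, `h2`: φ(P) A = P B, `hW`: w C = D
  -- want: r φ(P) = φ(rP) w
  have hP0 : (0 : ℝ) < P := by exact_mod_cast Nat.pos_of_ne_zero hP
  -- multiply the goal by `A * C > 0`
  have hAC : (0 : ℝ) < (∏ p ∈ P.primeFactors, (p : ℝ)) *
      ∏ p ∈ (r * P).primeFactors \ P.primeFactors, ((p : ℝ) - 1) := mul_pos hA hC
  refine mul_right_cancel₀ hAC.ne' ?_
  calc (r : ℝ) * (P.totient : ℝ) * ((∏ p ∈ P.primeFactors, (p : ℝ)) *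
        ∏ p ∈ (r * P).primeFactors \ P.primeFactors, ((p : ℝ) - 1))
      = r * ((P.totient : ℝ) * ∏ p ∈ P.primeFactors, (p : ℝ)) *
          ∏ p ∈ (r * P).primeFactors \ P.primeFactors, ((p : ℝ) - 1) := by ring
    _ = r * (P * ∏ p ∈ P.primeFactors, ((p : ℝ) - 1)) *
          ∏ p ∈ (r * P).primeFactors \ P.primeFactors, ((p : ℝ) - 1) := by rw [h2]
    _ = ((r * P : ℕ).totient : ℝ) * ((∏ p ∈ P.primeFactors, (p : ℝ)) *
          ∏ p ∈ (r * P).primeFactors \ P.primeFactors, (p : ℝ)) := by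
          linarith [h1]
    _ = ((r * P : ℕ).totient : ℝ) * primeWeight Ps r * ((∏ p ∈ P.primeFactors, (p : ℝ)) *
          ∏ p ∈ (r * P).primeFactors \ P.primeFactors, ((p : ℝ) - 1)) := by
          rw [← hW]; ring


/-! ## Columns of the matrix: prime counts in a segment of a progression against `ψ(·; M, j)` -/

/-- `ϑ(N; M, j) = ∑_{p ≤ N, p ≡ j (M)} log p` at a natural height `N` — the shape of the tree's
`Literature.NumberTheory.Sieve.sum_log_prime_modEq_le_chebyshevPsiMod` (the real-height
`BFIReduction.thetaMod` of `BombieriFriedlanderIwaniecProofs.lean` is the same function in another dress;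
that heavy file is deliberately not imported). [folklore] -/
def thetaMod (M j N : ℕ) : ℝ :=
  ∑ p ∈ (range (N + 1)).filter (fun p ↦ p.Prime ∧ p ≡ j [MOD M]), Real.log p

/-- The column count `#{X₁ < p ≤ X₂ : p prime, p ≡ j (mod M)}`. [folklore] -/
def colCount (M j X₁ X₂ : ℕ) : ℕ :=
  #((Ioc X₁ X₂).filter (fun p ↦ p.Prime ∧ p ≡ j [MOD M]))

/-- The log-weighted column sum is a `ϑ(·; M, j)`-difference. [folklore] -/
theorem sum_log_col_eq (M j : ℕ) {X₁ X₂ : ℕ} (h : X₁ ≤ X₂) :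
    ∑ p ∈ (Ioc X₁ X₂).filter (fun p ↦ p.Prime ∧ p ≡ j [MOD M]), Real.log p =
      thetaMod M j X₂ - thetaMod M j X₁ := by
  classical
  rw [thetaMod, thetaMod, Maier.sum_filter_range_succ_sub h]

/-- The sandwich `ψ(N;M,j) − (ψ(N) − ϑ(N)) ≤ ϑ(N;M,j) ≤ ψ(N;M,j)` (Montgomery–Vaughan, proof of
Cor. 11.20; tree: `sum_log_prime_modEq_le_chebyshevPsiMod`). [cite: MontgomeryVaughan2007, proof of Cor. 11.20] -/
theorem thetaMod_bounds (M j N : ℕ) :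
    thetaMod M j N ≤ chebyshevPsiMod M (j : ZMod M) N ∧
      chebyshevPsiMod M (j : ZMod M) N - (Chebyshev.psi N - Chebyshev.theta N) ≤ thetaMod M j N := by
  have h := Literature.NumberTheory.Sieve.sum_log_prime_modEq_le_chebyshevPsiMod (q := M) j N
  unfold thetaMod
  exact ⟨h.1, by linarith [h.2]⟩

/-- **Lower bound for a column** (source (5.3), lower half): for `X₁ ≤ X₂`,
`colCount · log X₂ ≥ ψ(X₂; M, j) − ψ(X₁; M, j) − (ψ(X₂) − ϑ(X₂))`.
[cite: FriedlanderGranville1992, §5 (5.2)–(5.3)] [cite: MontgomeryVaughan2007, proof of Cor. 11.20] -/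
theorem colCount_mul_log_ge (M j : ℕ) {X₁ X₂ : ℕ} (h : X₁ ≤ X₂) :
    chebyshevPsiMod M (j : ZMod M) X₂ - chebyshevPsiMod M (j : ZMod M) X₁ -
        (Chebyshev.psi X₂ - Chebyshev.theta X₂) ≤
      (colCount M j X₁ X₂ : ℝ) * Real.log X₂ := by
  have hsum : ∑ p ∈ (Ioc X₁ X₂).filter (fun p ↦ p.Prime ∧ p ≡ j [MOD M]), Real.log p ≤
      (colCount M j X₁ X₂ : ℝ) * Real.log X₂ := by
    rw [colCount, card_eq_sum_ones, Nat.cast_sum, sum_mul]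
    refine sum_le_sum fun p hp ↦ ?_
    rw [mem_filter, mem_Ioc] at hp
    rw [Nat.cast_one, one_mul]
    exact Real.log_le_log (by exact_mod_cast hp.2.1.pos) (by exact_mod_cast hp.1.2)
  rw [sum_log_col_eq M j h] at hsum
  have h2 := (thetaMod_bounds M j X₂).2
  have h1 := (thetaMod_bounds M j X₁).1
  linarith

/-- Counting a class in a segment: `#{A < n ≤ B : n ≡ j (M)} ≤ (B − A)/M + 1` for `M ≥ 1`. [folklore] -/
theorem card_Ioc_modEq_le {M : ℕ} (hM : 0 < M) (j : ℕ) {A B : ℕ} (h : A ≤ B) :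
    (#((Ioc A B).filter (fun n : ℕ ↦ n ≡ j [MOD M])) : ℝ) ≤ ((B : ℝ) - A) / M + 1 := by
  have := BFI.abs_card_Ioc_filter_modEq_sub_le hM j h
  rw [abs_le] at this
  linarith [this.2]

/-- **Upper bound for a column** (source (5.3)/(5.4), upper half): for `2 ≤ W`, `X₁ ≤ X₂`,
`W ≤ X₂` and `W' = max X₁ W`,
`colCount ≤ W/M + 1 + (ψ(X₂; M, j) − ψ(W'; M, j) + (ψ(W') − ϑ(W')))/log W`
(the primes up to `W'` are counted trivially in the class, those above have `log p ≥ log W`).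
[cite: FriedlanderGranville1992, §5 (5.2)–(5.4)] -/
theorem colCount_le {M : ℕ} (hM : 0 < M) (j : ℕ) {X₁ X₂ W : ℕ} (h : X₁ ≤ X₂) (hW : 2 ≤ W)
    (hWX : W ≤ X₂) :
    (colCount M j X₁ X₂ : ℝ) ≤ (W : ℝ) / M + 1 +
      (chebyshevPsiMod M (j : ZMod M) X₂ - chebyshevPsiMod M (j : ZMod M) ((max X₁ W : ℕ) : ℝ) +
        (Chebyshev.psi ((max X₁ W : ℕ) : ℝ) - Chebyshev.theta ((max X₁ W : ℕ) : ℝ))) / Real.log W := by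
  classical
  set W' : ℕ := max X₁ W with hW'
  have hX₁W' : X₁ ≤ W' := le_max_left _ _
  have hW'X₂ : W' ≤ X₂ := max_le h hWX
  have hWW' : W ≤ W' := le_max_right _ _
  have hlogW : 0 < Real.log W := Real.log_pos (by exact_mod_cast hW)
  -- split the segment at `W'`
  have hsplit : (colCount M j X₁ X₂ : ℝ) ≤ colCount M j X₁ W' + colCount M j W' X₂ := by
    have : colCount M j X₁ X₂ ≤ colCount M j X₁ W' + colCount M j W' X₂ := by
      unfold colCount
      rw [← Finset.Ioc_union_Ioc_eq_Ioc hX₁W' hW'X₂, filter_union]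
      exact card_union_le _ _
    exact_mod_cast this
  -- the lower part, trivially
  have hlow : (colCount M j X₁ W' : ℝ) ≤ (W : ℝ) / M + 1 := by
    have h1 : colCount M j X₁ W' ≤ #((Ioc X₁ W').filter (fun n : ℕ ↦ n ≡ j [MOD M])) := by
      unfold colCount
      exact card_le_card (fun n hn ↦ by
        rw [mem_filter] at hn ⊢; exact ⟨hn.1, hn.2.2⟩)
    have h2 := card_Ioc_modEq_le hM j hX₁W'
    have h3 : ((W' : ℝ) - X₁) / M ≤ (W : ℝ) / M := by
      refine div_le_div_of_nonneg_right ?_ (Nat.cast_nonneg M)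
      have : (W' : ℝ) ≤ max (X₁ : ℝ) W := by
        rw [hW']; push_cast; exact le_rfl
      rcases le_total X₁ W with hle | hle
      · have : W' = W := max_eq_right hle
        rw [this]; linarith [(Nat.cast_nonneg X₁ : (0 : ℝ) ≤ X₁)]
      · have : W' = X₁ := max_eq_left hle
        rw [this]; simp
    calc (colCount M j X₁ W' : ℝ) ≤ #((Ioc X₁ W').filter (fun n : ℕ ↦ n ≡ j [MOD M])) := by
          exact_mod_cast h1
      _ ≤ ((W' : ℝ) - X₁) / M + 1 := h2
      _ ≤ (W : ℝ) / M + 1 := by linarith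
  -- the upper part, through `ϑ(·; M, j)`
  have hup : (colCount M j W' X₂ : ℝ) * Real.log W ≤
      chebyshevPsiMod M (j : ZMod M) X₂ - chebyshevPsiMod M (j : ZMod M) W' +
        (Chebyshev.psi W' - Chebyshev.theta W') := by
    have hsum : (colCount M j W' X₂ : ℝ) * Real.log W ≤
        ∑ p ∈ (Ioc W' X₂).filter (fun p ↦ p.Prime ∧ p ≡ j [MOD M]), Real.log p := by
      rw [colCount, card_eq_sum_ones, Nat.cast_sum, sum_mul]
      refine sum_le_sum fun p hp ↦ ?_
      rw [mem_filter, mem_Ioc] at hp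
      rw [Nat.cast_one, one_mul]
      exact Real.log_le_log (by positivity) (by exact_mod_cast (hWW'.trans hp.1.1.le))
    rw [sum_log_col_eq M j hW'X₂] at hsum
    have h2 := (thetaMod_bounds M j X₂).1
    have h1 := (thetaMod_bounds M j W').2
    linarith
  rw [← le_div_iff₀ hlogW] at hup
  linarith


/-! ## Brun–Titchmarsh for a column -/

/-- **Brun–Titchmarsh for a column** (source (5.4), in the weak form of the tree's
`card_roughAP_le`): with the absolute constant `K` of that theorem, for `z ≥ 2`, `M ≥ 1`,
`(j, M) = 1` and all `X₁, X₂`: `colCount M j X₁ X₂ ≤ K (X₂/(φ(M) log z) + z^{10}) + z + 1`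
(primes `≥ z` are `z`-rough; the others number at most `z + 1`).
[cite: FriedlanderGranville1992, §5 (5.4)] [cite: HalberstamRichert1974, Ch. 3 (Brun–Titchmarsh theorem)] -/
theorem colCount_le_brunTitchmarsh :
    ∃ K : ℝ, 0 < K ∧ ∀ z : ℝ, 2 ≤ z → ∀ M : ℕ, 0 < M → ∀ j : ℕ, j.Coprime M → ∀ X₁ X₂ : ℕ,
      (colCount M j X₁ X₂ : ℝ) ≤
        K * ((X₂ : ℝ) / ((Nat.totient M : ℝ) * Real.log z) + z ^ (10 : ℕ)) + z + 1 := by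
  classical
  obtain ⟨K, hK, h⟩ := card_roughAP_le
  refine ⟨K, hK, fun z hz M hM j hj X₁ X₂ ↦ ?_⟩
  have hrough := h z hz M hM j hj (X₂ : ℝ) (Nat.cast_nonneg X₂)
  rw [Nat.floor_natCast] at hrough
  -- split the primes of the column at `z`
  have hsplit : colCount M j X₁ X₂ ≤
      #((Ioc 0 X₂).filter (fun n : ℕ ↦ n ≡ j [MOD M] ∧ n.Coprime (primesProdBelow z))) +
        #((Ioc 0 X₂).filter (fun n : ℕ ↦ (n : ℝ) < z)) := by
    unfold colCount
    calc #((Ioc X₁ X₂).filter (fun p ↦ p.Prime ∧ p ≡ j [MOD M]))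
        ≤ #(((Ioc 0 X₂).filter (fun n : ℕ ↦ n ≡ j [MOD M] ∧ n.Coprime (primesProdBelow z))) ∪
            ((Ioc 0 X₂).filter (fun n : ℕ ↦ (n : ℝ) < z))) := by
          refine card_le_card fun p hp ↦ ?_
          rw [mem_filter, mem_Ioc] at hp
          obtain ⟨⟨h1, h2⟩, hp, hmod⟩ := hp
          rw [mem_union, mem_filter, mem_filter, mem_Ioc]
          by_cases hpz : (p : ℝ) < z
          · exact Or.inr ⟨⟨hp.pos, h2⟩, hpz⟩
          · refine Or.inl ⟨⟨hp.pos, h2⟩, hmod, ?_⟩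
            rw [coprime_primesProdBelow_iff]
            intro q hq hqp
            rw [Nat.mem_primesBelow] at hq
            have : q = p := (Nat.prime_dvd_prime_iff_eq hq.2 hp).1 hqp
            subst this
            exact hpz (Nat.lt_ceil.1 hq.1)
      _ ≤ _ := card_union_le _ _
  have hsmall : (#((Ioc 0 X₂).filter (fun n : ℕ ↦ (n : ℝ) < z)) : ℝ) ≤ z + 1 := by
    have h1 : (Ioc 0 X₂).filter (fun n : ℕ ↦ (n : ℝ) < z) ⊆ range (⌊z⌋₊ + 1) := by
      intro n hn
      rw [mem_filter] at hn
      rw [mem_range, Nat.lt_succ_iff]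
      exact Nat.le_floor hn.2.le
    have h2 : (#((Ioc 0 X₂).filter (fun n : ℕ ↦ (n : ℝ) < z)) : ℝ) ≤ ⌊z⌋₊ + 1 := by
      have := card_le_card h1
      rw [card_range] at this
      exact_mod_cast this
    have h3 : (⌊z⌋₊ : ℝ) ≤ z := Nat.floor_le (by linarith)
    linarith
  calc (colCount M j X₁ X₂ : ℝ)
      ≤ #((Ioc 0 X₂).filter (fun n : ℕ ↦ n ≡ j [MOD M] ∧ n.Coprime (primesProdBelow z))) +
          #((Ioc 0 X₂).filter (fun n : ℕ ↦ (n : ℝ) < z)) := by exact_mod_cast hsplit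
    _ ≤ K * ((X₂ : ℝ) / ((Nat.totient M : ℝ) * Real.log z) + z ^ (10 : ℕ)) + (z + 1) :=
        add_le_add hrough hsmall
    _ = _ := by ring

/-! ## The prime number theorem for `π(x)` -/

/-- **The prime number theorem, two-sided with `ε`** (from the tree's
`primeCounting_isEquivalent_holds`, `π(x) ∼ x/log x`): for every `ε > 0` there is `x₀` with
`|π(x) − x/log x| ≤ ε x/log x` for all real `x ≥ x₀`, `π(x) = Nat.primeCounting ⌊x⌋₊`.
[cite: Poussin1896] -/
theorem primeCounting_bounds {ε : ℝ} (hε : 0 < ε) :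
    ∃ x₀ : ℝ, ∀ x : ℝ, x₀ ≤ x →
      |(Nat.primeCounting ⌊x⌋₊ : ℝ) - x / Real.log x| ≤ ε * (x / Real.log x) := by
  have h := Literature.NumberTheory.LFunctions.primeCounting_isEquivalent_holds
  have hb := (h.isLittleO.bound hε)
  obtain ⟨x₀, hx₀⟩ := eventually_atTop.1 (hb.and (eventually_gt_atTop 1))
  refine ⟨x₀, fun x hx ↦ ?_⟩
  obtain ⟨h1, hx1⟩ := hx₀ x hx
  have hpos : 0 < x / Real.log x := div_pos (by linarith) (Real.log_pos hx1)
  simp only [Pi.sub_apply, Real.norm_eq_abs] at h1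
  rwa [abs_of_pos hpos] at h1

/-! ## Mertens-type bounds for sieve densities -/

/-- **Lower bound for a sieve density**: for a finite set `Ps` of primes all `≤ N`, `N ≥ 2`,
`W(Ps) = ∏_{p∈Ps}(1 − 1/p) ≥ e^{−5}/log N` (tree: `MertensBound.exp_neg_div_log_le_prod_one_sub_inv`).
[cite: HardyWright2008, Thm 429 (§22.8)] -/
theorem sieveDensity_ge {Ps : Finset ℕ} (hPs : ∀ p ∈ Ps, p.Prime) {N : ℕ} (hN : 2 ≤ N)
    (hPsN : ∀ p ∈ Ps, p ≤ N) : Real.exp (-5) / Real.log N ≤ sieveDensity Ps := by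
  have h1 := Literature.NumberTheory.LFunctions.MertensBound.exp_neg_div_log_le_prod_one_sub_inv N hN
  refine h1.trans ?_
  rw [sieveDensity]
  have hsub : Ps ⊆ Nat.primesLE N := fun p hp ↦ Nat.mem_primesLE.2 ⟨hPsN p hp, hPs p hp⟩
  calc ∏ p ∈ Nat.primesLE N, (1 - 1 / (p : ℝ)) = ∏ p ∈ Nat.primesLE N, (1 - (p : ℝ)⁻¹) := by
        simp_rw [one_div]
    _ ≤ ∏ p ∈ Ps, (1 - (p : ℝ)⁻¹) := by
        refine prod_le_prod_of_subset_of_le_one hsub (fun p hp ↦ ?_) (fun p hp _ ↦ ?_)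
        · exact sub_nonneg.2 (Nat.cast_inv_le_one p)
        · exact sub_le_self _ (inv_nonneg.2 (Nat.cast_nonneg p))

/-- `∏_{p∈Ps}(1 + 1/p) ≤ exp(∑_{p∈Ps} 1/p)`. [folklore] -/
theorem prod_one_add_inv_le_exp (Ps : Finset ℕ) :
    ∏ p ∈ Ps, (1 + (p : ℝ)⁻¹) ≤ Real.exp (∑ p ∈ Ps, (p : ℝ)⁻¹) := by
  rw [Real.exp_sum]
  exact prod_le_prod (fun p _ ↦ by positivity) fun p _ ↦ by
    linarith [Real.add_one_le_exp ((p : ℝ)⁻¹)]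

/- Monotonicity and nonnegativity of `ψ(·; q, a)`: use the tree's
`Literature.NumberTheory.Sieve.chebyshevPsiMod_mono` / `chebyshevPsiMod_nonneg`
(`ElliottHalberstamBridgeProofs.lean`); the two copies `ParityWave0.chebyshevPsiMod` and
`LevelOfDistribution.chebyshevPsiMod` are definitionally equal (`ParityBarrier.lean`). -/

/-- `ψ(x; q, a) ≤ ψ(x) ≤ (log 4 + 4) x` for `x ≥ 0` (Chebyshev). [folklore] -/
theorem chebyshevPsiMod_le_psi (q : ℕ) (a : ZMod q) {x : ℝ} (hx : 0 ≤ x) :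
    chebyshevPsiMod q a x ≤ (Real.log 4 + 4) * x := by
  have h1 : chebyshevPsiMod q a x ≤ Chebyshev.psi x := by
    rw [chebyshevPsiMod, Chebyshev.psi_eq_sum_Icc, Nat.range_succ_eq_Icc_zero]
    refine sum_le_sum fun n _ ↦ ?_
    exact ArithmeticFunction.vonMangoldt.residueClass_le a n
  exact h1.trans (Chebyshev.psi_le_const_mul_self hx)

end Literature.Barriers.Parity.FriedlanderGranville
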